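import Literature.MathematicalPhysics.QuantumFieldTheory.Balaban1983to89.Node00.MultiScaleFibreChartLagrange
import Literature.MathematicalPhysics.QuantumFieldTheory.Balaban1983to89.Node00.MultiScaleFibreChartB

/-!
# NODE 00 — THE LAGRANGE FORM OF (82)∕(83) AT A CURVE-CRITICAL CONFIGURATION OF A MULTI-SCALE FIBRE **OVER A BOND-LEVEL DATUM `𝐁ᵇ`**, AND «MINIMAL ⇒ CRITICAL ⇒ `hlam`» AT THE BOND-DATUM CHART
# `msChartB` — the print-datum ([Balaban1984PropagatorsII] (2.3)) edition of `Node00/MultiScaleFibreChartLagrange` §1–§4, keyed on the lane's `Node00/MultiScaleFibreChartB` ∕ `CriticalOnFibreTangentB`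
# and n07-e's F0b `CriticalOnFibreB`

statement-level skeleton of published theorems with citation tags; proofs where landed; nothing here is a claim about
the Yang–Mills mass gap

Cell `pub-ymgap` (HUMAN RULINGS D-0062 ∕ D-0149), lane `pub-ymgap-dag-n12-c` g35 (R134 seat (a), N12 = [B15], s1, lane owner); `--kind proof --supports` K1⁹ `stmt-QuantumFields-27364`;
count-neutral.  THEOREMS ONLY (0 `def`, 0 `instance`, 0 `sorry`).  (E1) variant (iii-b), class (γ) of the lane's census-by-declaration (bus [DAGN12C-G35], 2026-08-30): TEN declarations of the parent
with datum-bearing statements are used by N12's junction of record v14ᴸ (`differentiableAt_msChart`, `eventually_differentiableAt_msChart`, `exists_lam_of_isFibreChartNear_of_isCritOnFibre`,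
`fderiv_wilsonAction4_expChart_apply_eq_zero_of_isCritOnFibre_near`, `hasFDerivAt_fderiv_msChart`, `hasFDerivAt_msChart`, `isCritOnFibre_of_isMinimizer_of_eventually_mem`,
`isCritOnFibre_of_isMinimizer_regMSCoPOfRecord(At)`, `regularity_binders_msChart`).  GENERATOR twin (HOME `lean/g35/gen/gen_LagB.py` over the parent's tree bytes, every substitution asserted): `(𝐁 : DetSet) ↦
(𝔅 : BDetSet)`, `AgreeOn ↦ AgreeOnB`, `bondsOf (𝐁 j) ↦ 𝔅 j`, `IsFibreChartNear ↦ IsFibreChartNearB`, `IsCritOnFibre ↦ IsCritOnFibreB`, `IsMinimizer ↦ IsMinimizerB`, `msChart ∕ constrCard ↦ msChartB ∕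
constrCardB`, the Fermat step ↦ F0b's `deriv_wilsonAction4_eq_zero_of_isMinimizerB` ∕ `isCritOnFibreB_of_isMinimizerB_class17`; the datum-free multiplier algebra (dag-n12-w3's
`exists_multiplier_of_surjective ∕ multiplier_unique`, `abs_multiplier_apply_le_seminorm`, dag-n12-w1's `eventually_mem_regMSCoPOfRecordAt`) REUSED by name.  The parent's two `…_Bj_…`
specialisations become the generic-𝔅 `exists_lam_msChartB_of_isMinimizerB_regMSCoPOfRecord` (+ the print instance `…_lamBondsSeq_…` via F0a `lamBondsSeq_of_gt`).

HONESTY GUARD (director-ym №338 (5)).  PURELY ADDITIVE: the parent stays landed and true on its own text; nothing in it, in n07-w2's chart module, 35a, F0a or F0b is edited; no displayed premise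
of any consumer is deleted or weakened.  (45)'s onto-ness ∕ right inverse stays a DISPLAYED HYPOTHESIS; nothing of [15] asserted; K0⁷ ∕ K1⁹ NOT closed; N07 ∕ N12 NOT discharged; one finite 𝕋⁴ programme
at fixed ε — NOT continuum ∕ ℝ⁴ ∕ OS ∕ mass gap ∕ Clay.

WHAT IS HERE.  §1 `fderiv_wilsonAction4_expChart_apply_eq_zero_of_isCritOnFibreB_near` · ★★ `exists_lam_of_isFibreChartNearB_of_isCritOnFibreB` · `lam_unique_of_isFibreChartNearB`; §2
`isFibreChartNearB_msChartB_of_surjective` · `fderiv_…_of_isCritOnFibreB_of_surjective` · ★★★ `exists_lam_msChartB_of_surjective` · `lam_msChartB_unique` · `exists_lam_msChartB_of_rightInverse(_fun)` ·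
`exists_lam_msChartB_bound_of_rightInverse_fun`; §3 `hasFDerivAt_msChartB` · `differentiableAt_msChartB` · ★ `hasFDerivAt_fderiv_msChartB` · ★ `eventually_differentiableAt_msChartB` ·
`eventually_contDiffAt_two_msChartB` · `regularity_binders_msChartB`; §4 ★ `isCritOnFibreB_of_isMinimizerB_of_eventually_mem` · `exists_lam_msChartB_of_isMinimizerB_of_eventually_mem` ·
`exists_lam_msChartB_of_isMinimizerB_class17` · ★★ `isCritOnFibreB_of_isMinimizerB_regMSCoPOfRecord(At)` · ★★★ `exists_lam_msChartB_of_isMinimizerB_regMSCoPOfRecord` · `…_lamBondsSeq_…`.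

References: [15] = [Balaban1985Variational] (2),(5)–(7) p.278, Sect. C (36)–(48) pp.283–285, (81)–(83) p.290, (141) p.299, p.300, (170)–(171) p.305; [Balaban1989LargeFieldII] (1.12) p.359, p.357;
[Balaban1985RegularSpaces] (1.7),(1.9) p.77; [III] = [Balaban1988Convergent] p.255, (2.10)–(2.13) pp.256–257; [II] = [Balaban1984PropagatorsII] (2.3) p.224.
-/

noncomputable section

namespace Literature.MathematicalPhysics.QuantumFieldTheory.Balaban1983to89.Node00

open Filter Topology
open T4Continuum (T4Family)
open B15DeterminingSets B15DeterminingSetsB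
open T4AdjointCovarianceUnitary (lieSU)
open B11Eq177CriticalFamilyDerivative (contDiff_wilsonAction4_expChart exists_multiplier_of_surjective multiplier_unique)
open B16Ineq17NearFlatOneSidedSeminorm (abs_multiplier_apply_le_seminorm)
open B15Prop1ClassOpenAtRecord (eventually_mem_regMSCoPOfRecordAt)
open B14.Eq213DetSet (maxDomT)
open scoped Matrix.Norms.L2Operator

variable {F : T4Family} {N : ℕ} [NeZero N]
variable {K k : ℕ} {𝔅 : BDetSet (F.P K)} {W : MSField (F.P K) (SU N)} {U : GaugeField (F.P K) 0 (SU N)}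

/-! ## §1  Any submersive chart of the constraint: tangent-criticality in Fréchet form, and the Lagrange form -/

section Abstract

variable {V : Type*} [NormedAddCommGroup V] [NormedSpace ℝ V] [FiniteDimensional ℝ V]
  {Φ : (PBond (F.P K) 0 → lieSU (Fin N)) → V} {Φ' : (PBond (F.P K) 0 → lieSU (Fin N)) →L[ℝ] V}

/-- ★ **CURVE-CRITICAL ⇒ THE FIRST VARIATION KILLS `ker Φ′` (Fréchet form of (82)∕(83))**: for a submersive chart `Φ` of the constraint near `U₀` (35a `IsFibreChartNear`) and
`U₀` curve-critical on the fibre, `D(A∘expChart U₀)(0)X = 0` for every `X` with `Φ′X = 0` — 35a's ray statement `d∕dt A(U₀·e^{tX})∣₀ = 0` read through the Fréchet derivative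
of the `C^ω` map `A∘expChart U₀` (dag-n12-w3's `contDiff_wilsonAction4_expChart`). [cite: Balaban1985Variational, (82)–(83) p.290, (141) p.299, p.300; Balaban1989LargeFieldII, (1.12) p.359] -/
theorem fderiv_wilsonAction4_expChart_apply_eq_zero_of_isCritOnFibreB_near
    (hΦ : IsFibreChartNearB F N K 𝔅 W U Φ Φ') (hcrit : IsCritOnFibreB F N K 𝔅 W U)
    {X : PBond (F.P K) 0 → lieSU (Fin N)} (hX : Φ' X = 0) :
    fderiv ℝ (fun Y : PBond (F.P K) 0 → lieSU (Fin N) => wilsonAction4 (expChart U Y)) 0 X = 0 := by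
  have hd : DifferentiableAt ℝ (fun Y : PBond (F.P K) 0 → lieSU (Fin N) => wilsonAction4 (expChart U Y)) 0 :=
    ((contDiff_wilsonAction4_expChart U).differentiable (by simp)).differentiableAt
  have hray : HasDerivAt (fun t : ℝ => wilsonAction4 (expChart U (t • X)))
      (fderiv ℝ (fun Y : PBond (F.P K) 0 → lieSU (Fin N) => wilsonAction4 (expChart U Y)) 0 X) 0 :=
    hd.hasFDerivAt.comp_hasDerivAt_of_eq (0 : ℝ) (hasDerivAt_ray X) (zero_smul ℝ X).symm
  exact hray.unique (hasDerivAt_wilsonAction4_expChart_of_isCritOnFibreB_near hΦ hcrit hX)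

/-- ★★ **THE LAGRANGE FORM AT A CURVE-CRITICAL CONFIGURATION, ANY SUBMERSIVE CHART**: `D(A∘expChart U₀)(0) = λ₀ ∘ Φ′` for some continuous linear `λ₀ : V → ℝ` — the first variation
kills `ker Φ′` (above) and `Φ′` is ONTO (the chart hypothesis), so it factors (dag-n12-w3's `exists_multiplier_of_surjective`).  This is the binder `hlam` of the near-flat one-sided
(1.7) skeleton (`B16Ineq17NearFlatWilsonLetters`, `B15Prop1SliceHessianOfChartFamily` §4) at `Ψ := Φ`. [cite: Balaban1985Variational, (82)–(83) p.290, (170)–(171) p.305; Balaban1989LargeFieldII, (1.12) p.359, p.357] -/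
theorem exists_lam_of_isFibreChartNearB_of_isCritOnFibreB
    (hΦ : IsFibreChartNearB F N K 𝔅 W U Φ Φ') (hcrit : IsCritOnFibreB F N K 𝔅 W U) :
    ∃ lam : V →L[ℝ] ℝ, fderiv ℝ (fun Y : PBond (F.P K) 0 → lieSU (Fin N) => wilsonAction4 (expChart U Y)) 0 = lam.comp Φ' := by
  have hsurj : Function.Surjective Φ' := by
    have h := LinearMap.range_eq_top.1 hΦ.2.1
    exact h
  exact exists_multiplier_of_surjective _ Φ' hsurj
    (fun X hX => fderiv_wilsonAction4_expChart_apply_eq_zero_of_isCritOnFibreB_near hΦ hcrit hX)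

/-- The multiplier of a submersive chart is unique (`Φ′` onto). [cite: Balaban1985Variational, (82)–(83) p.290 (bookkeeping)] -/
theorem lam_unique_of_isFibreChartNearB (hΦ : IsFibreChartNearB F N K 𝔅 W U Φ Φ') {lam lam' : V →L[ℝ] ℝ}
    (h : fderiv ℝ (fun Y : PBond (F.P K) 0 → lieSU (Fin N) => wilsonAction4 (expChart U Y)) 0 = lam.comp Φ')
    (h' : fderiv ℝ (fun Y : PBond (F.P K) 0 → lieSU (Fin N) => wilsonAction4 (expChart U Y)) 0 = lam'.comp Φ') : lam = lam' := by
  have hsurj : Function.Surjective Φ' := by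
    have hr := LinearMap.range_eq_top.1 hΦ.2.1
    exact hr
  exact multiplier_unique hsurj h h'

end Abstract

/-! ## §2  The chart of record `Ψ := msChartB F N K k 𝐁 W U₀`: the binder `hlam` from onto-ness of `DΨ(0)` and curve-criticality -/

section Record

/-- **35a's `IsFibreChartNear` FOR THE CHART OF RECORD, FROM ONTO-NESS OF `DΨ(0)` STATED DIRECTLY** (the currency dag-n10-w1's `surjective_fderiv_msChartB_of_flat` delivers, and the one this
seat's `B16Ineq17NearFlatSubmersion.surjective_of_opNorm_sub_lt` produces from a flat right inverse + (δ₂)): strict differentiability and the level-set clause are n07-w2's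
`hasStrictFDerivAt_msChartB` ∕ `eventually_agreeOn_of_msChartB_eq`. [cite: Balaban1985Variational, Sect. C (44)–(48) p.285, (82)–(83) p.290; Balaban1988Convergent, (2.10)–(2.12) p.256] -/
theorem isFibreChartNearB_msChartB_of_surjective (h𝔅 : ∀ j, k < j → 𝔅 j = ∅) (hU : AgreeOnB 𝔅 (avgFamily (avOfRecord F N K) U) W)
    (hsb : SmallBelow (avOfRecord F N K) k U) (hsurj : Function.Surjective (fderiv ℝ (msChartB F N K k 𝔅 W U) 0)) :
    IsFibreChartNearB F N K 𝔅 W U (msChartB F N K k 𝔅 W U) (fderiv ℝ (msChartB F N K k 𝔅 W U) 0) :=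
  ⟨hasStrictFDerivAt_msChartB hU hsb, LinearMap.range_eq_top.2 hsurj, eventually_agreeOnB_of_msChartB_eq h𝔅 hU hsb⟩

/-- ★ **AT THE CHART OF RECORD, THE FIRST VARIATION KILLS `ker DΨ(0)`** (`hφ` of this seat's `B16Ineq17NearFlatSubmersion.exists_multiplier_of_opNorm_sub_lt`, DISCHARGED): for `𝐁` with no
member above `k`, `U₀` in the fibre with guarded averages, `DΨ(0)` onto and `U₀` curve-critical on the fibre, `DΨ(0)X = 0 ⇒ D(A∘expChart U₀)(0)X = 0`.
[cite: Balaban1985Variational, (82)–(83) p.290, p.300; Balaban1989LargeFieldII, (1.12) p.359] -/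
theorem fderiv_wilsonAction4_expChart_apply_eq_zero_of_isCritOnFibreB_of_surjective (h𝔅 : ∀ j, k < j → 𝔅 j = ∅)
    (hU : AgreeOnB 𝔅 (avgFamily (avOfRecord F N K) U) W) (hsb : SmallBelow (avOfRecord F N K) k U)
    (hsurj : Function.Surjective (fderiv ℝ (msChartB F N K k 𝔅 W U) 0)) (hcrit : IsCritOnFibreB F N K 𝔅 W U)
    {X : PBond (F.P K) 0 → lieSU (Fin N)} (hX : fderiv ℝ (msChartB F N K k 𝔅 W U) 0 X = 0) :
    fderiv ℝ (fun Y : PBond (F.P K) 0 → lieSU (Fin N) => wilsonAction4 (expChart U Y)) 0 X = 0 :=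
  fderiv_wilsonAction4_expChart_apply_eq_zero_of_isCritOnFibreB_near (isFibreChartNearB_msChartB_of_surjective h𝔅 hU hsb hsurj) hcrit hX

/-- ★★★ **THE BINDER `hlam` OF THE J-C JUNCTION AT THE CHART OF RECORD** (`B15Prop1SliceHessianOfChartFamily.h17Shape_sliceFn_of_nearFlatCriticalExpChartFamily`, `Ψ := msChartB F N K k 𝐁 W U₀`):
for a determining set with no member above `k`, a configuration `U₀` in the fibre `𝔅(𝐁, W)` whose iterated averages are guarded (`SmallBelow`), with `DΨ(0)` ONTO ([15] (45) at `U₀` —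
dag-n10-w1's `surjective_fderiv_msChartB_of_flat` at guarded near-flat backgrounds) and `U₀` a CRITICAL CONFIGURATION OF (5) ON THE FIBRE in the curve form (`IsCritOnFibre` — n07-e's
«minimal ⇒ critical», dag-n12-w6's `hcritT`-transfer): `D(A∘expChart U₀)(0) = λ₀ ∘ DΨ(0)` for some continuous linear `λ₀`.
[cite: Balaban1985Variational, (82)–(83) p.290, (170)–(171) p.305, Sect. C (45)–(48) p.285; Balaban1989LargeFieldII, (1.12) p.359, p.357; Balaban1988Convergent, (2.10)–(2.12) p.256] -/
theorem exists_lam_msChartB_of_surjective (h𝔅 : ∀ j, k < j → 𝔅 j = ∅)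
    (hU : AgreeOnB 𝔅 (avgFamily (avOfRecord F N K) U) W) (hsb : SmallBelow (avOfRecord F N K) k U)
    (hsurj : Function.Surjective (fderiv ℝ (msChartB F N K k 𝔅 W U) 0)) (hcrit : IsCritOnFibreB F N K 𝔅 W U) :
    ∃ lam : (Fin (constrCardB 𝔅 k) → lieSU (Fin N)) →L[ℝ] ℝ,
      fderiv ℝ (fun Y : PBond (F.P K) 0 → lieSU (Fin N) => wilsonAction4 (expChart U Y)) 0 = lam.comp (fderiv ℝ (msChartB F N K k 𝔅 W U) 0) :=
  exists_lam_of_isFibreChartNearB_of_isCritOnFibreB (isFibreChartNearB_msChartB_of_surjective h𝔅 hU hsb hsurj) hcrit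

/-- The multiplier at the chart of record is unique once `DΨ(0)` is onto. [cite: Balaban1985Variational, (82)–(83) p.290 (bookkeeping)] -/
theorem lam_msChartB_unique (hsurj : Function.Surjective (fderiv ℝ (msChartB F N K k 𝔅 W U) 0))
    {lam lam' : (Fin (constrCardB 𝔅 k) → lieSU (Fin N)) →L[ℝ] ℝ}
    (h : fderiv ℝ (fun Y : PBond (F.P K) 0 → lieSU (Fin N) => wilsonAction4 (expChart U Y)) 0 = lam.comp (fderiv ℝ (msChartB F N K k 𝔅 W U) 0))
    (h' : fderiv ℝ (fun Y : PBond (F.P K) 0 → lieSU (Fin N) => wilsonAction4 (expChart U Y)) 0 = lam'.comp (fderiv ℝ (msChartB F N K k 𝔅 W U) 0)) :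
    lam = lam' :=
  multiplier_unique hsurj h h'

/-- ★★ **`hlam` FROM A RIGHT INVERSE OF THE LINEARISED CONSTRAINT IN VELOCITY CURRENCY** (n07-w2's `hH`: every family of tangent targets `W_j(c)·τ_j(c)` on the constrained bonds of
levels `≤ k` is the velocity family of `t ↦ Ū^j(U₀·e^{tX})(c)` for some `X` — [15] (45) at `U₀`, existence only): n07-w2's `isFibreChartNear_msChartB` + §1.
[cite: Balaban1985Variational, Sect. C (45)–(48) p.285, (82)–(83) p.290, (170)–(171) p.305; Balaban1988Convergent, (2.10)–(2.12) p.256] -/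
theorem exists_lam_msChartB_of_rightInverse (h𝔅 : ∀ j, k < j → 𝔅 j = ∅)
    (hU : AgreeOnB 𝔅 (avgFamily (avOfRecord F N K) U) W) (hsb : SmallBelow (avOfRecord F N K) k U)
    (hH : ∀ τ : (j : ℕ) → PBond (F.P K) j → lieSU (Fin N), ∃ X : PBond (F.P K) 0 → lieSU (Fin N), ∀ j, j ≤ k → ∀ c ∈ (𝔅 j),
      HasDerivAt (fun t : ℝ => ((avgFamily (avOfRecord F N K) (expChart U (t • X)) j c : SU N) : Matrix (Fin N) (Fin N) ℂ))
        (((W j c : SU N) : Matrix (Fin N) (Fin N) ℂ) * ((τ j c : lieSU (Fin N)) : Matrix (Fin N) (Fin N) ℂ)) 0)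
    (hcrit : IsCritOnFibreB F N K 𝔅 W U) :
    ∃ lam : (Fin (constrCardB 𝔅 k) → lieSU (Fin N)) →L[ℝ] ℝ,
      fderiv ℝ (fun Y : PBond (F.P K) 0 → lieSU (Fin N) => wilsonAction4 (expChart U Y)) 0 = lam.comp (fderiv ℝ (msChartB F N K k 𝔅 W U) 0) :=
  exists_lam_of_isFibreChartNearB_of_isCritOnFibreB (isFibreChartNearB_msChartB h𝔅 hU hsb hH) hcrit

/-- ★★ **`hlam` FROM A RIGHT INVERSE OF `DΨ(0)` AS A FUNCTION** (the pointwise currency of the skeleton's binders `Rf`∕`hRf` — dag-n10-w1's `exists_rightInverse_fderiv_msChartB_of_flat`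
delivers a real-linear `H` with `DΨ(0)(H y) = y` at every guarded near-flat background; this seat's `B16Ineq17NearFlatSubmersion.exists_rightInverse_fun_of_opNorm_sub_lt` delivers one from a flat
right inverse + (δ₂)): onto-ness is read off the right inverse, then §2. [cite: Balaban1985Variational, Sect. C (45)–(48) p.285, (82)–(83) p.290, (170)–(171) p.305; Balaban1989LargeFieldII, (1.12) p.359] -/
theorem exists_lam_msChartB_of_rightInverse_fun (h𝔅 : ∀ j, k < j → 𝔅 j = ∅)
    (hU : AgreeOnB 𝔅 (avgFamily (avOfRecord F N K) U) W) (hsb : SmallBelow (avOfRecord F N K) k U)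
    {R : (Fin (constrCardB 𝔅 k) → lieSU (Fin N)) → PBond (F.P K) 0 → lieSU (Fin N)} (hR : ∀ v, fderiv ℝ (msChartB F N K k 𝔅 W U) 0 (R v) = v)
    (hcrit : IsCritOnFibreB F N K 𝔅 W U) :
    ∃ lam : (Fin (constrCardB 𝔅 k) → lieSU (Fin N)) →L[ℝ] ℝ,
      fderiv ℝ (fun Y : PBond (F.P K) 0 → lieSU (Fin N) => wilsonAction4 (expChart U Y)) 0 = lam.comp (fderiv ℝ (msChartB F N K k 𝔅 W U) 0) :=
  exists_lam_msChartB_of_surjective h𝔅 hU hsb (fun v => ⟨R v, hR v⟩) hcrit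

/-- ★★ **THE QUANTITATIVE EDITION IN THE JUNCTION's SEMINORM CURRENCY — `hlam` WITH THE MULTIPLIER BOUND `|λ₀ v| ≤ j·ρ·q(v)`**: sizes by a seminorm `p` on the chart space and any size
`q` on the constraint space (dag-n12-c's word (ii): `p` = the `ℓ²(bonds)` norm at the record), a right inverse `R` of `DΨ(0)` as a function with `p(Rv) ≤ ρ·q(v)` (letters (ρ♭)+(δ₂) combined:
`ρ_act = ρ♭∕(1 − δ₂ρ♭)`), the CURRENT bound `|D(A∘expChart U₀)(0)x| ≤ j·p(x)` (this seat's `WilsonActionFirstVariationNearFlat` ∕ `B16Ineq17NearFlatWilsonLetters.letter_j_wilson`), and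
curve-criticality: then `D(A∘expChart U₀)(0) = λ₀ ∘ DΨ(0)` with `|λ₀ v| ≤ j·ρ·q(v)` — §2 + this seat's g2 `B16Ineq17NearFlatOneSidedSeminorm.abs_multiplier_apply_le_seminorm`; with a bound
`q(Ψ₂(w,w)) ≤ M₂·p(w)²` on the chart's curvature this is the letter (μ) `= j·ρ·M₂` of the skeleton (`B16Ineq17NearFlatOneSided.multiplier_letter_of_current`; `M₂` displayed).
[cite: Balaban1985Variational, (36)–(47) pp.283–285, (82)–(83) p.290, (170)–(171) p.305; Balaban1989LargeFieldII, (1.12) p.359, p.357] -/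
theorem exists_lam_msChartB_bound_of_rightInverse_fun (h𝔅 : ∀ j, k < j → 𝔅 j = ∅)
    (hU : AgreeOnB 𝔅 (avgFamily (avOfRecord F N K) U) W) (hsb : SmallBelow (avOfRecord F N K) k U)
    (p : Seminorm ℝ (PBond (F.P K) 0 → lieSU (Fin N))) (q : (Fin (constrCardB 𝔅 k) → lieSU (Fin N)) → ℝ)
    {R : (Fin (constrCardB 𝔅 k) → lieSU (Fin N)) → PBond (F.P K) 0 → lieSU (Fin N)} (hR : ∀ v, fderiv ℝ (msChartB F N K k 𝔅 W U) 0 (R v) = v)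
    {j ρ : ℝ} (hj0 : 0 ≤ j) (hj : ∀ x, |fderiv ℝ (fun Y : PBond (F.P K) 0 → lieSU (Fin N) => wilsonAction4 (expChart U Y)) 0 x| ≤ j * p x)
    (hρ : ∀ v, p (R v) ≤ ρ * q v) (hcrit : IsCritOnFibreB F N K 𝔅 W U) :
    ∃ lam : (Fin (constrCardB 𝔅 k) → lieSU (Fin N)) →L[ℝ] ℝ,
      fderiv ℝ (fun Y : PBond (F.P K) 0 → lieSU (Fin N) => wilsonAction4 (expChart U Y)) 0 = lam.comp (fderiv ℝ (msChartB F N K k 𝔅 W U) 0) ∧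
        ∀ v, |lam v| ≤ j * ρ * q v := by
  obtain ⟨lam, hlam⟩ := exists_lam_msChartB_of_rightInverse_fun h𝔅 hU hsb hR hcrit
  exact ⟨lam, hlam, fun v => abs_multiplier_apply_le_seminorm p q _ _ hR hlam hj0 hj hρ v⟩

end Record

/-! ## §3  Regularity of the chart of record at `0`: the binders `hΨ₂` ∕ `hΨd` of the junction (and the first derivative) -/

section Regularity

/-- The chart of record is Fréchet-differentiable at `0` with derivative `DΨ(0) := fderiv ℝ Ψ 0` (from n07-w2's strict differentiability).
[cite: Balaban1985Variational, (82)–(83) p.290 (bookkeeping)] -/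
theorem hasFDerivAt_msChartB (hU : AgreeOnB 𝔅 (avgFamily (avOfRecord F N K) U) W) (hsb : SmallBelow (avOfRecord F N K) k U) :
    HasFDerivAt (msChartB F N K k 𝔅 W U) (fderiv ℝ (msChartB F N K k 𝔅 W U) 0) 0 :=
  (hasStrictFDerivAt_msChartB hU hsb).hasFDerivAt

/-- The chart of record is differentiable at `0`. [cite: Balaban1985Variational, (82)–(83) p.290 (bookkeeping)] -/
theorem differentiableAt_msChartB (hU : AgreeOnB 𝔅 (avgFamily (avOfRecord F N K) U) W) (hsb : SmallBelow (avOfRecord F N K) k U) :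
    DifferentiableAt ℝ (msChartB F N K k 𝔅 W U) 0 :=
  (hasFDerivAt_msChartB hU hsb).differentiableAt

/-- ★ **THE BINDER `hΨ₂` AT THE CHART OF RECORD**: `Y ↦ DΨ(Y)` is Fréchet-differentiable at `0` with derivative `Ψ₂ := D²Ψ(0) = fderiv ℝ (fderiv ℝ Ψ) 0` — the chart is `C^∞` at `0`
(n07-w2's `contDiffAt_msChartB`), in particular `C²`. [cite: Balaban1985Variational, (81)–(83) p.290 (second-order expansion at the background); Balaban1989LargeFieldII, (1.12) p.359] -/
theorem hasFDerivAt_fderiv_msChartB (hU : AgreeOnB 𝔅 (avgFamily (avOfRecord F N K) U) W) (hsb : SmallBelow (avOfRecord F N K) k U) :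
    HasFDerivAt (fun Y => fderiv ℝ (msChartB F N K k 𝔅 W U) Y) (fderiv ℝ (fderiv ℝ (msChartB F N K k 𝔅 W U)) 0) 0 := by
  have h2 : ContDiffAt ℝ 2 (msChartB F N K k 𝔅 W U) 0 := (contDiffAt_msChartB hU hsb).of_le le_top
  exact ((h2.fderiv_right (m := 1) (by norm_num)).differentiableAt (by norm_num)).hasFDerivAt

/-- ★ **THE BINDER `hΨd` AT THE CHART OF RECORD**: the chart is differentiable at every point near `0`. [cite: Balaban1985Variational, (81)–(83) p.290 (bookkeeping)] -/
theorem eventually_differentiableAt_msChartB (hU : AgreeOnB 𝔅 (avgFamily (avOfRecord F N K) U) W) (hsb : SmallBelow (avOfRecord F N K) k U) :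
    ∀ᶠ Y in 𝓝 (0 : PBond (F.P K) 0 → lieSU (Fin N)), DifferentiableAt ℝ (msChartB F N K k 𝔅 W U) Y := by
  have h2 : ContDiffAt ℝ 2 (msChartB F N K k 𝔅 W U) 0 := (contDiffAt_msChartB hU hsb).of_le le_top
  exact (h2.eventually (by simp)).mono fun Y hY => hY.differentiableAt (by norm_num)

/-- The chart is `C²` at every point near `0` (so the binders persist along a family through `0`). [cite: Balaban1985Variational, (81)–(83) p.290 (bookkeeping)] -/
theorem eventually_contDiffAt_two_msChartB (hU : AgreeOnB 𝔅 (avgFamily (avOfRecord F N K) U) W) (hsb : SmallBelow (avOfRecord F N K) k U) :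
    ∀ᶠ Y in 𝓝 (0 : PBond (F.P K) 0 → lieSU (Fin N)), ContDiffAt ℝ 2 (msChartB F N K k 𝔅 W U) Y := by
  have h2 : ContDiffAt ℝ 2 (msChartB F N K k 𝔅 W U) 0 := (contDiffAt_msChartB hU hsb).of_le le_top
  exact h2.eventually (by simp)

/-- **THE J-C REGULARITY PAIR IN ONE LINE**: `hΨ₂` with `Ψ₂ := D²Ψ(0)` and `hΨd`, at the chart of record. [cite: Balaban1985Variational, (81)–(83) p.290 (bookkeeping)] -/
theorem regularity_binders_msChartB (hU : AgreeOnB 𝔅 (avgFamily (avOfRecord F N K) U) W) (hsb : SmallBelow (avOfRecord F N K) k U) :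
    HasFDerivAt (fun Y => fderiv ℝ (msChartB F N K k 𝔅 W U) Y) (fderiv ℝ (fderiv ℝ (msChartB F N K k 𝔅 W U)) 0) 0 ∧
      ∀ᶠ Y in 𝓝 (0 : PBond (F.P K) 0 → lieSU (Fin N)), DifferentiableAt ℝ (msChartB F N K k 𝔅 W U) Y :=
  ⟨hasFDerivAt_fderiv_msChartB hU hsb, eventually_differentiableAt_msChartB hU hsb⟩

end Regularity

/-! ## §4  From minimality: a minimiser over a class that is a neighbourhood of it is curve-critical, hence `hlam`; the class and determining set of record -/

section Minimal

/-- ★ **«MINIMAL ⇒ CRITICAL» OVER ANY CLASS THAT IS A NEIGHBOURHOOD OF THE MINIMISER** (generalising n07-e's `isCritOnFibre_of_isMinimizer_class17` ∕ `…_class6` ∕ `…_classTop` to an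
abstract class `reg` with `∀ᶠ V in 𝓝 U₀, V ∈ reg` — the shape dag-n12-w1's `B15Prop1ClassOpenAtRecord.eventually_mem_regMSCoPOfRecordAt` delivers for NODE 00's class of record): a curve through the
minimiser, differentiable at `0` as a curve of bond matrices, is continuous there, so stays in `reg` for small times, and Fermat applies on the fibre (`deriv_wilsonAction4_eq_zero_of_isMinimizer`).
[cite: Balaban1985Variational, (6) p.278, p.299 («minimal configuration»), p.300; Balaban1988Convergent, (2.12) p.256] -/
theorem isCritOnFibreB_of_isMinimizerB_of_eventually_mem {reg : Set (GaugeField (F.P K) 0 (SU N))}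
    (h : IsMinimizerB (avOfRecord F N K) reg 𝔅 W U) (hreg : ∀ᶠ V in 𝓝 U, V ∈ reg) : IsCritOnFibreB F N K 𝔅 W U := by
  intro γ h0 hd hc a ha
  have hγ : ContinuousAt (fun t (b : PBond (F.P K) 0) => γ t b) 0 := continuousAt_of_differentiableAt_val hd
  have hct : Tendsto (fun t (b : PBond (F.P K) 0) => γ t b) (𝓝 0) (𝓝 U) := by
    have ht : Tendsto (fun t (b : PBond (F.P K) 0) => γ t b) (𝓝 0) (𝓝 (fun b => γ 0 b)) := hγ.tendsto
    rw [h0] at ht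
    exact ht
  have hreg' : ∀ᶠ t in 𝓝 (0 : ℝ), γ t ∈ reg := hct.eventually hreg
  exact deriv_wilsonAction4_eq_zero_of_isMinimizerB h h0 hreg' hc ha

/-- ★★ **`hlam` AT THE CHART OF RECORD FOR A MINIMISER OVER A CLASS THAT IS A NEIGHBOURHOOD OF IT** (onto-ness of `DΨ(0)` and the guard `hsb` displayed; the fibre condition is part of
`IsMinimizer`). [cite: Balaban1985Variational, (82)–(83) p.290, p.299–300; Balaban1989LargeFieldII, (1.12) p.359; Balaban1988Convergent, (2.12) p.256] -/
theorem exists_lam_msChartB_of_isMinimizerB_of_eventually_mem (h𝔅 : ∀ j, k < j → 𝔅 j = ∅) {reg : Set (GaugeField (F.P K) 0 (SU N))}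
    (h : IsMinimizerB (avOfRecord F N K) reg 𝔅 W U) (hreg : ∀ᶠ V in 𝓝 U, V ∈ reg) (hsb : SmallBelow (avOfRecord F N K) k U)
    (hsurj : Function.Surjective (fderiv ℝ (msChartB F N K k 𝔅 W U) 0)) :
    ∃ lam : (Fin (constrCardB 𝔅 k) → lieSU (Fin N)) →L[ℝ] ℝ,
      fderiv ℝ (fun Y : PBond (F.P K) 0 → lieSU (Fin N) => wilsonAction4 (expChart U Y)) 0 = lam.comp (fderiv ℝ (msChartB F N K k 𝔅 W U) 0) :=
  exists_lam_msChartB_of_surjective h𝔅 h.2.1 hsb hsurj (isCritOnFibreB_of_isMinimizerB_of_eventually_mem h hreg)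

/-- ★★ **`hlam` AT THE CHART OF RECORD FOR A MINIMISER OVER THE (1.7)-CLASS** (def-R's `regMSOfRecord` reading of (2.12): `{U | ∀ n ≤ k′, |U(∂p) − 1| < r_n on omegaPlaqs Ω n}`, ANY
thresholds; n07-e's `isCritOnFibre_of_isMinimizer_class17`). [cite: Balaban1985Variational, (6) p.278, (82)–(83) p.290, p.299–300; Balaban1985RegularSpaces, (1.7) p.77; Balaban1988Convergent, (2.12) p.256] -/
theorem exists_lam_msChartB_of_isMinimizerB_class17 (h𝔅 : ∀ j, k < j → 𝔅 j = ∅) {k' : ℕ} {Ω : ℕ → Set (Site (F.P K) 0)} {r : ℕ → ℝ}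
    (h : IsMinimizerB (avOfRecord F N K) {V | ∀ n, n ≤ k' → PlaqSmallOn (omegaPlaqs Ω n) (r n) V} 𝔅 W U)
    (hsb : SmallBelow (avOfRecord F N K) k U) (hsurj : Function.Surjective (fderiv ℝ (msChartB F N K k 𝔅 W U) 0)) :
    ∃ lam : (Fin (constrCardB 𝔅 k) → lieSU (Fin N)) →L[ℝ] ℝ,
      fderiv ℝ (fun Y : PBond (F.P K) 0 → lieSU (Fin N) => wilsonAction4 (expChart U Y)) 0 = lam.comp (fderiv ℝ (msChartB F N K k 𝔅 W U) 0) :=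
  exists_lam_msChartB_of_surjective h𝔅 h.2.1 hsb hsurj (isCritOnFibreB_of_isMinimizerB_class17 h)

/-- ★★ **«MINIMAL ⇒ CRITICAL» AT NODE 00's CLASS ON A SUPPORT `regMSCoPOfRecordAt F N ν K k′ Ω₀ Ω`** (print's (6) = (1.7) ∧ (1.9) on the top sequence of `Ω₀, Ω`, the class the N12∕s1
endpoint's solution map `bgMSCoPOfRecord` minimises over): the class is a neighbourhood of each member (dag-n12-w1's `eventually_mem_regMSCoPOfRecordAt`), so every minimiser of (2.12) over it
is curve-critical on its fibre — the hypothesis `hcrit` of §2 DISCHARGED at the record's class. [cite: Balaban1985Variational, (2),(6) p.278, p.299–300; Balaban1985RegularSpaces, (1.7),(1.9) p.77; Balaban1988Convergent, (2.12) p.256] -/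
theorem isCritOnFibreB_of_isMinimizerB_regMSCoPOfRecordAt (ν : Stage7Numerics) {k' : ℕ} (Ω₀ : Set (Site (F.P K) 0)) (Ω : ℕ → Set (Site (F.P K) 0))
    (h : IsMinimizerB (avOfRecord F N K) (regMSCoPOfRecordAt F N ν K k' Ω₀ Ω) 𝔅 W U) : IsCritOnFibreB F N K 𝔅 W U :=
  isCritOnFibreB_of_isMinimizerB_of_eventually_mem h (eventually_mem_regMSCoPOfRecordAt F N ν K k' Ω₀ Ω h.1)

/-- ★★ The same at THE CLASS OF RECORD `regMSCoPOfRecord F N ν K k′ Ω` (support of record). [cite: Balaban1985Variational, (2),(6) p.278, p.299–300; Balaban1988Convergent, p.255, (2.12) p.256] -/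
theorem isCritOnFibreB_of_isMinimizerB_regMSCoPOfRecord (ν : Stage7Numerics) {k' : ℕ} (Ω : ℕ → Set (Site (F.P K) 0))
    (h : IsMinimizerB (avOfRecord F N K) (regMSCoPOfRecord F N ν K k' Ω) 𝔅 W U) : IsCritOnFibreB F N K 𝔅 W U :=
  isCritOnFibreB_of_isMinimizerB_regMSCoPOfRecordAt ν _ Ω h


/-- ★★★ **`hlam` AT THE RE-KEYED N12 ENDPOINT's OBJECTS, generic bond datum** — class of record `regMSCoPOfRecord F N ν K k′ Ω` (print's (2), unchanged), a bond datum `𝔅` with no member above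
`k` (print's [II] (2.3): `lamBondsSeq (maxDomT M₁ Z) k`, `lamBondsSeq_of_gt`; reading (b): `bondsDet (Bj M₁ Z k)`), any datum `W`, `U₀` a MINIMAL CONFIGURATION of (2.12) there: given the guard
`hsb` and onto-ness of `DΨᴮ(0)`, `D(A∘expChart U₀)(0) = λ₀ ∘ DΨᴮ(0)` at `Ψᴮ := msChartB F N K k 𝔅 W U₀`; twin of `exists_lam_msChart_Bj_of_isMinimizer_regMSCoPOfRecord` (`hcrit` discharged by minimality).
[cite: Balaban1985Variational, (82)–(83) p.290, (170)–(171) p.305, p.299–300; Balaban1989LargeFieldII, (1.12) p.359, p.357; Balaban1988Convergent, (2.12)–(2.13) pp.256–257; Balaban1984PropagatorsII, (2.3) p.224] -/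
theorem exists_lam_msChartB_of_isMinimizerB_regMSCoPOfRecord (ν : Stage7Numerics) {k' : ℕ} (Ω : ℕ → Set (Site (F.P K) 0)) (h𝔅 : ∀ j, k < j → 𝔅 j = ∅)
    {W : MSField (F.P K) (SU N)} {U₀ : GaugeField (F.P K) 0 (SU N)}
    (h : IsMinimizerB (avOfRecord F N K) (regMSCoPOfRecord F N ν K k' Ω) 𝔅 W U₀)
    (hsb : SmallBelow (avOfRecord F N K) k U₀) (hsurj : Function.Surjective (fderiv ℝ (msChartB F N K k 𝔅 W U₀) 0)) :
    ∃ lam : (Fin (constrCardB 𝔅 k) → lieSU (Fin N)) →L[ℝ] ℝ,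
      fderiv ℝ (fun Y : PBond (F.P K) 0 → lieSU (Fin N) => wilsonAction4 (expChart U₀ Y)) 0 = lam.comp (fderiv ℝ (msChartB F N K k 𝔅 W U₀) 0) :=
  exists_lam_msChartB_of_surjective h𝔅 h.2.1 hsb hsurj (isCritOnFibreB_of_isMinimizerB_regMSCoPOfRecord ν Ω h)

/-- The same on PRINT's [II] (2.3) datum at `Z`'s maximal sequence `𝔅 := lamBondsSeq (maxDomT M₁ Z) k` (no member above `k` by F0a `lamBondsSeq_of_gt`).
[cite: Balaban1984PropagatorsII, (2.3) p.224; Balaban1988Convergent, (2.12)–(2.13) pp.256–257; Balaban1985Variational, (82)–(83) p.290] -/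
theorem exists_lam_msChartB_lamBondsSeq_of_isMinimizerB_regMSCoPOfRecord (ν : Stage7Numerics) {k' : ℕ} (Ω : ℕ → Set (Site (F.P K) 0)) (M₁ : ℕ) (Z : Set (Site (F.P K) 0))
    {W : MSField (F.P K) (SU N)} {U₀ : GaugeField (F.P K) 0 (SU N)}
    (h : IsMinimizerB (avOfRecord F N K) (regMSCoPOfRecord F N ν K k' Ω) (lamBondsSeq (maxDomT M₁ Z) k) W U₀)
    (hsb : SmallBelow (avOfRecord F N K) k U₀) (hsurj : Function.Surjective (fderiv ℝ (msChartB F N K k (lamBondsSeq (maxDomT M₁ Z) k) W U₀) 0)) :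
    ∃ lam : (Fin (constrCardB (lamBondsSeq (maxDomT M₁ Z) k) k) → lieSU (Fin N)) →L[ℝ] ℝ,
      fderiv ℝ (fun Y : PBond (F.P K) 0 → lieSU (Fin N) => wilsonAction4 (expChart U₀ Y)) 0 =
        lam.comp (fderiv ℝ (msChartB F N K k (lamBondsSeq (maxDomT M₁ Z) k) W U₀) 0) :=
  exists_lam_msChartB_of_isMinimizerB_regMSCoPOfRecord ν Ω (fun _ hj => lamBondsSeq_of_gt _ k hj) h hsb hsurj

end Minimal

end Literature.MathematicalPhysics.QuantumFieldTheory.Balaban1983to89.Node00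

end
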